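import Summits.Ventures.Crystal3D.Theorems.StickyWulffConstantNoReconstructionGainExactPrep
import Summits.Ventures.Crystal3D.Theorems.StickyWulffConstantNoReconstructionGainOffLattice
import Summits.Ventures.Crystal3D.Theorems.StickyWulffConstantGenericWallFloorMixedDozenRules
import HarnessLib

/-!
# Criminals: the structure lemma and the smallest cases (line `replication-exactness`, rungs R1/R2)

HONEST FRAMING. Part of the venture `Summits/Ventures/Crystal3D` (cell `crystal3d-full`), supports the
crux `NoReconstructionGain` (stmt-Ventures-19144, route `route-Ventures-StickyWulffConstant`), line
`replication-exactness` (lead wulff-p1 g17).  With `not_noReconstructionGain_of_criminal` landed (one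
criminal refutes the crux), the decidable rungs `NoSmallCriminal(n)` of the line card start here:

* `plugSet_ncard_le_three_of_not_mem` — an OFF-SITE ball has at most `3` plugs
  (`fcc_offLattice_unitContacts_le_three`);
* `plugSlots`, `plugSet_ncard_eq_card_plugSlots`, `plugSlots_disjoint_neg`, `card_plugSlots_le_six`,
  `mem_or_neg_mem_plugSlots_of_card_eq_six` — an ON-SITE film ball has at most `6` plugs (its plug
  slots and their antipodes are disjoint: a plug slot points down to the half-crystal, its antipode up),
  and EXACTLY `6` plugs means every slot is a plug slot or the antipode of one;
* `seven_le_plug_add_deg_of_criminal` — R1: in a criminal every ball has `plug + deg_Q ≥ 7`;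
* `two_le_card_of_criminal`, `three_le_card_of_criminal` — R2: **no criminal has fewer than three balls**
  (two balls would both be sites with six plugs, adjacent by a slot `w₀`; the six-plug dichotomy at both
  ends forces `⟪w₀, ν⟫ > 0` and `< 0`).

WHAT THIS IS NOT: `NoSmallCriminal(n)` for `n ≥ 3` (interval certificates, kit) and the crux proper
(`stub_noCriminal`) are open; rung F-C1 not moved.
-/

noncomputable section

namespace Summit.Ventures.Crystal3D.Theorems

open Summit.Ventures.Crystal3D
open Literature.MathematicalPhysics.StatisticalMechanics (fccStacking contactDeficiency orderedContacts)
open scoped InnerProductSpace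
open Finset

/-! ## Off-site balls -/

/-- An off-site ball has at most three plugs. -/
theorem plugSet_ncard_le_three_of_not_mem {ν : EuclideanSpace ℝ (Fin 3)} {s : ℝ}
    {q : EuclideanSpace ℝ (Fin 3)} (hq : q ∉ fccStacking 1 (Real.sqrt (2 / 3))) :
    (plugSet ν s q).ncard ≤ 3 := by
  classical
  have hfin := plugSet_finite ν s q
  rw [Set.ncard_eq_toFinset_card _ hfin]
  exact fcc_offLattice_unitContacts_le_three q hq hfin.toFinset fun y hy => by
    obtain ⟨⟨hyΛ, -⟩, hd⟩ := hfin.mem_toFinset.1 hy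
    exact ⟨hyΛ, hd⟩

/-! ## On-site balls: plug slots -/

/-- The plug SLOTS of a site `q`: the bond vectors `w` with `q + w` in the half-crystal. -/
def plugSlots (ν : EuclideanSpace ℝ (Fin 3)) (s : ℝ) (q : EuclideanSpace ℝ (Fin 3)) :
    Finset (EuclideanSpace ℝ (Fin 3)) := by
  classical
  exact fccSlots.filter fun w => q + w ∈ halfCrystal ν s

/-- For a site, the plug set is the translate of the plug slots. -/
theorem plugSet_eq_image_plugSlots {ν : EuclideanSpace ℝ (Fin 3)} {s : ℝ} {q : EuclideanSpace ℝ (Fin 3)}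
    (hq : q ∈ fccStacking 1 (Real.sqrt (2 / 3))) :
    plugSet ν s q = (fun w => q + w) '' (plugSlots ν s q : Set (EuclideanSpace ℝ (Fin 3))) := by
  classical
  ext z
  constructor
  · rintro ⟨hz, hd⟩
    refine ⟨z - q, ?_, by abel⟩
    rw [Finset.mem_coe, plugSlots, Finset.mem_filter]
    refine ⟨sub_mem_fccSlots_of_dist_eq_one hq hz.1 hd, ?_⟩
    rw [add_sub_cancel]; exact hz
  · rintro ⟨w, hw, rfl⟩
    rw [Finset.mem_coe, plugSlots, Finset.mem_filter] at hw
    refine ⟨hw.2, ?_⟩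
    rw [dist_eq_norm, sub_add_cancel_left, norm_neg, norm_eq_one_of_mem_fccSlots hw.1]

/-- Hence the number of plugs of a site is the number of its plug slots. -/
theorem plugSet_ncard_eq_card_plugSlots {ν : EuclideanSpace ℝ (Fin 3)} {s : ℝ}
    {q : EuclideanSpace ℝ (Fin 3)} (hq : q ∈ fccStacking 1 (Real.sqrt (2 / 3))) :
    (plugSet ν s q).ncard = (plugSlots ν s q).card := by
  rw [plugSet_eq_image_plugSlots hq, Set.ncard_image_of_injective _ (add_right_injective q),
    Set.ncard_coe_finset]

/-- A plug slot points DOWN (`⟪w, ν⟫ < 0`) when the site is above the cut. -/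
theorem inner_neg_of_mem_plugSlots {ν : EuclideanSpace ℝ (Fin 3)} {s : ℝ} {q w : EuclideanSpace ℝ (Fin 3)}
    (hqs : s < ⟪q, ν⟫_ℝ) (hw : w ∈ plugSlots ν s q) : ⟪w, ν⟫_ℝ < 0 := by
  classical
  rw [plugSlots, Finset.mem_filter] at hw
  have h := hw.2.2
  rw [inner_add_left] at h
  linarith

/-- Plug slots and antipodes of plug slots are disjoint (above the cut). -/
theorem neg_not_mem_plugSlots {ν : EuclideanSpace ℝ (Fin 3)} {s : ℝ} {q w : EuclideanSpace ℝ (Fin 3)}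
    (hqs : s < ⟪q, ν⟫_ℝ) (hw : w ∈ plugSlots ν s q) : -w ∉ plugSlots ν s q := by
  intro hw'
  have h1 := inner_neg_of_mem_plugSlots hqs hw
  have h2 := inner_neg_of_mem_plugSlots hqs hw'
  rw [inner_neg_left] at h2
  linarith

/-- **A site above the cut has at most six plug slots**, and with exactly six every slot is a plug slot
or the antipode of one. -/
theorem card_plugSlots_le_six_and {ν : EuclideanSpace ℝ (Fin 3)} {s : ℝ} {q : EuclideanSpace ℝ (Fin 3)}
    (hqs : s < ⟪q, ν⟫_ℝ) :
    (plugSlots ν s q).card ≤ 6 ∧ ((plugSlots ν s q).card = 6 →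
      ∀ w ∈ fccSlots, w ∈ plugSlots ν s q ∨ -w ∈ plugSlots ν s q) := by
  classical
  set P := plugSlots ν s q with hP
  set N := P.image fun w => -w with hN
  have hPsub : P ⊆ fccSlots := by rw [hP, plugSlots]; exact Finset.filter_subset _ _
  have hNsub : N ⊆ fccSlots := by
    intro w hw
    obtain ⟨w', hw', rfl⟩ := Finset.mem_image.1 hw
    exact neg_mem_fccSlots (hPsub hw')
  have hNcard : N.card = P.card := Finset.card_image_of_injective _ neg_injective
  have hdisj : Disjoint P N := by
    rw [Finset.disjoint_left]
    intro w hw hwN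
    obtain ⟨w', hw', hww⟩ := Finset.mem_image.1 hwN
    have : -w' ∈ P := by rw [hww]; exact hw
    exact neg_not_mem_plugSlots hqs hw' this
  have hunion : (P ∪ N).card = P.card + P.card := by
    rw [Finset.card_union_of_disjoint hdisj, hNcard]
  have hle : (P ∪ N).card ≤ 12 := by
    rw [← card_fccSlots]; exact Finset.card_le_card (Finset.union_subset hPsub hNsub)
  refine ⟨by omega, fun h6 w hw => ?_⟩
  have heq : P ∪ N = fccSlots :=
    Finset.eq_of_subset_of_card_le (Finset.union_subset hPsub hNsub) (by rw [card_fccSlots, hunion, h6])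
  rw [← heq, Finset.mem_union] at hw
  rcases hw with hw | hw
  · exact Or.inl hw
  · obtain ⟨w', hw', hww⟩ := Finset.mem_image.1 hw
    right; rw [← hww, neg_neg]; exact hw'

/-- A film ball is above the cut. -/
theorem lt_inner_of_isFilmOn {ν : EuclideanSpace ℝ (Fin 3)} {s : ℝ} {Q : Finset (EuclideanSpace ℝ (Fin 3))}
    (hQ : IsFilmOn ν s Q) {q : EuclideanSpace ℝ (Fin 3)} (hq : q ∈ Q)
    (hqΛ : q ∈ fccStacking 1 (Real.sqrt (2 / 3))) : s < ⟪q, ν⟫_ℝ := by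
  by_contra h
  have := hQ.2 q hq q ⟨hqΛ, not_lt.1 h⟩
  rw [dist_self] at this
  linarith

/-- **Every film ball has at most six plugs** (sites: six; off-site balls: three). -/
theorem plugSet_ncard_le_six_of_isFilmOn {ν : EuclideanSpace ℝ (Fin 3)} {s : ℝ}
    {Q : Finset (EuclideanSpace ℝ (Fin 3))} (hQ : IsFilmOn ν s Q) {q : EuclideanSpace ℝ (Fin 3)}
    (hq : q ∈ Q) : (plugSet ν s q).ncard ≤ 6 := by
  by_cases hqΛ : q ∈ fccStacking 1 (Real.sqrt (2 / 3))
  · rw [plugSet_ncard_eq_card_plugSlots hqΛ]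
    exact (card_plugSlots_le_six_and (lt_inner_of_isFilmOn hQ hq hqΛ)).1
  · exact (plugSet_ncard_le_three_of_not_mem hqΛ).trans (by norm_num)

/-! ## Criminals: the structure lemma and the smallest cases -/

/-- **R1: in a criminal every ball is strictly over-attached**: `plug(q) + deg_Q(q) ≥ 7`. -/
theorem seven_le_plug_add_deg_of_criminal {ν : EuclideanSpace ℝ (Fin 3)} {s : ℝ}
    {Q : Finset (EuclideanSpace ℝ (Fin 3))} (hQ : IsCriminal ν s Q) {q : EuclideanSpace ℝ (Fin 3)}
    (hq : q ∈ Q) : 7 ≤ (plugSet ν s q).ncard + (Q.filter fun y => dist q y = 1).card := by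
  classical
  have h := hQ.2.2 {q} (Finset.singleton_subset_iff.2 hq) (Finset.singleton_nonempty q)
  rw [contactDeficiency_singleton, plugCount, Finset.sum_singleton, card_cross_sdiff_singleton] at h
  have h' : (6 : ℝ) < (((plugSet ν s q).ncard + (Q.filter fun y => dist q y = 1).card : ℕ) : ℝ) := by
    push_cast; linarith
  exact_mod_cast h'

/-- **No criminal has one ball.** -/
theorem two_le_card_of_criminal {ν : EuclideanSpace ℝ (Fin 3)} {s : ℝ}
    {Q : Finset (EuclideanSpace ℝ (Fin 3))} (hQ : IsCriminal ν s Q) : 2 ≤ Q.card := by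
  classical
  by_contra hlt
  push Not at hlt
  obtain ⟨q, hq⟩ := hQ.2.1
  have hcard : Q.card = 1 := by
    have := Finset.card_pos.2 ⟨q, hq⟩; omega
  obtain ⟨q₀, hQ₀⟩ := Finset.card_eq_one.1 hcard
  have hq₀ : q = q₀ := by rw [hQ₀] at hq; exact Finset.mem_singleton.1 hq
  subst hq₀
  have h7 := seven_le_plug_add_deg_of_criminal hQ hq
  have h0 : (Q.filter fun y => dist q y = 1).card = 0 := by
    rw [Finset.card_eq_zero, Finset.filter_eq_empty_iff]
    intro y hy
    rw [hQ₀, Finset.mem_singleton] at hy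
    rw [hy, dist_self]; norm_num
  have h6 := plugSet_ncard_le_six_of_isFilmOn hQ.1 hq
  omega

/-- **No criminal has two balls.** -/
theorem three_le_card_of_criminal {ν : EuclideanSpace ℝ (Fin 3)} {s : ℝ}
    {Q : Finset (EuclideanSpace ℝ (Fin 3))} (hQ : IsCriminal ν s Q) : 3 ≤ Q.card := by
  classical
  have h2 := two_le_card_of_criminal hQ
  by_contra hlt
  push Not at hlt
  have hcard : Q.card = 2 := by omega
  obtain ⟨q₁, q₂, hne, hQ₁₂⟩ := Finset.card_eq_two.1 hcard
  -- both balls: six plugs, sites, adjacent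
  have key : ∀ a b : EuclideanSpace ℝ (Fin 3), Q = {a, b} → a ≠ b →
      a ∈ fccStacking 1 (Real.sqrt (2 / 3)) ∧ (plugSlots ν s a).card = 6 ∧ dist a b = 1 := by
    intro a b hab hne'
    have ha : a ∈ Q := by rw [hab]; exact Finset.mem_insert_self a {b}
    have h7 := seven_le_plug_add_deg_of_criminal hQ ha
    have hdeg : (Q.filter fun y => dist a y = 1).card ≤ 1 := by
      calc (Q.filter fun y => dist a y = 1).card ≤ ({b} : Finset _).card := by
            refine Finset.card_le_card fun y hy => ?_
            rw [Finset.mem_filter, hab, Finset.mem_insert, Finset.mem_singleton] at hy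
            rcases hy.1 with rfl | rfl
            · rw [dist_self] at hy; norm_num at hy
            · exact Finset.mem_singleton_self _
        _ = 1 := Finset.card_singleton b
    have h6 := plugSet_ncard_le_six_of_isFilmOn hQ.1 ha
    have haΛ : a ∈ fccStacking 1 (Real.sqrt (2 / 3)) := by
      by_contra h
      have := plugSet_ncard_le_three_of_not_mem (ν := ν) (s := s) h
      omega
    have hpl : (plugSet ν s a).ncard = 6 := by omega
    have hd1 : (Q.filter fun y => dist a y = 1).card = 1 := by omega
    obtain ⟨y, hy⟩ := Finset.card_eq_one.1 hd1
    have hy' : y ∈ Q.filter fun y => dist a y = 1 := by rw [hy]; exact Finset.mem_singleton_self y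
    rw [Finset.mem_filter, hab, Finset.mem_insert, Finset.mem_singleton] at hy'
    have hyb : y = b := by
      rcases hy'.1 with rfl | rfl
      · rw [dist_self] at hy'; norm_num at hy'
      · rfl
    rw [hyb] at hy'
    exact ⟨haΛ, by rw [← plugSet_ncard_eq_card_plugSlots haΛ]; exact hpl, hy'.2⟩
  obtain ⟨h₁Λ, h₁6, hd⟩ := key q₁ q₂ hQ₁₂ hne
  obtain ⟨h₂Λ, h₂6, -⟩ := key q₂ q₁ (by rw [hQ₁₂, Finset.pair_comm]) hne.symm
  have hq₁ : q₁ ∈ Q := by rw [hQ₁₂]; exact Finset.mem_insert_self _ _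
  have hq₂ : q₂ ∈ Q := by rw [hQ₁₂]; exact Finset.mem_insert_of_mem (Finset.mem_singleton_self _)
  have hs₁ := lt_inner_of_isFilmOn hQ.1 hq₁ h₁Λ
  have hs₂ := lt_inner_of_isFilmOn hQ.1 hq₂ h₂Λ
  -- the slot from `q₁` to `q₂`
  have hw₀ : q₂ - q₁ ∈ fccSlots := sub_mem_fccSlots_of_dist_eq_one h₁Λ h₂Λ hd
  have hw₀' : q₁ - q₂ ∈ fccSlots := by
    have := neg_mem_fccSlots hw₀; rwa [neg_sub] at this
  -- neither ball is a plug of the other (film balls are above the cut)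
  have hnot : ∀ {a b : EuclideanSpace ℝ (Fin 3)}, b ∈ Q → b ∈ fccStacking 1 (Real.sqrt (2 / 3)) →
      b - a ∉ plugSlots ν s a := by
    intro a b hb hbΛ h
    classical
    rw [plugSlots, Finset.mem_filter, add_sub_cancel] at h
    have := hQ.1.2 b hb b h.2
    rw [dist_self] at this; linarith
  -- six-plug dichotomy at both ends
  have d₁ := (card_plugSlots_le_six_and hs₁).2 h₁6 (q₂ - q₁) hw₀
  have d₂ := (card_plugSlots_le_six_and hs₂).2 h₂6 (q₁ - q₂) hw₀'
  rcases d₁ with d₁ | d₁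
  · exact hnot hq₂ h₂Λ d₁
  rcases d₂ with d₂ | d₂
  · exact hnot hq₁ h₁Λ d₂
  have e₁ := inner_neg_of_mem_plugSlots hs₁ d₁
  have e₂ := inner_neg_of_mem_plugSlots hs₂ d₂
  rw [inner_neg_left, inner_sub_left] at e₁ e₂
  -- `q₁ - (q₂ - q₁)` a plug of `q₁`: height `2⟪q₁⟫ - ⟪q₂⟫ ≤ s`; `q₂ - (q₁ - q₂)` a plug of `q₂`
  classical
  have f₁ : ⟪q₁ + -(q₂ - q₁), ν⟫_ℝ ≤ s := by
    have := d₁; rw [plugSlots, Finset.mem_filter] at this; exact this.2.2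
  have f₂ : ⟪q₂ + -(q₁ - q₂), ν⟫_ℝ ≤ s := by
    have := d₂; rw [plugSlots, Finset.mem_filter] at this; exact this.2.2
  rw [inner_add_left, inner_neg_left, inner_sub_left] at f₁ f₂
  linarith

end Summit.Ventures.Crystal3D.Theorems

end
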